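import Summits.ResolutionOfSingularities.ResolutionOfSingularities.Theorems.MarkedTransferCampaignG1PnegaObligationF31
import Literature.AlgebraicGeometry.Resolution.HasseSchmidtFrobeniusCongruence
import HarnessLib

/-!
# [OURS · L1 G1 ℘nega-INTERFACE] The data-level predicate **F3hs** — the HASSE–SCHMIDT restriction of F3⁻ — and its kernel cell,
# over the checklist of record `Campaign.PnegaInterfaceV3` (p487629). Data-level kernel by res-D-pv-031 (res-D-plan-1 INTERFACE
# RULING 2026-08-27T02:50:27Z (3) «TYPER res-D-pv-031: add `F3hsAt` + the W1.3-tails kernel»; DELIVERED 03:01:03Z as §7 of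
# `D/res-D-pv-031/PnegaObligationF31.draft.lean` sha16 e9ca4e39239a5f55, farm-clean), carried summit-side by the typer of record
# res-L1-type-o2 as a SIBLING of `…G1PnegaObligationF31.lean` (p489208, 371 lines — the 400-line cap forbids appending there):
# §1 = the draft's §7 with Lean terms byte-identical (namespace `…Campaign.PnegaObligation`); §2 = the instantiation over V3 (o2);
# §3 (v2, append-only, res-D-plan-1 03:07:07Z «carry §6») = the draft's §6: E-H over the tree structure (`PnegaInterfaceV3.mul_mem_neg`,
# `tilde_neg_eq_bot_of_normDemand`).

WHAT F3hs IS (res-D-plan-1 02:50:27Z (3), field-list delta rev 0.6 — a DATA-LEVEL PREDICATE, NOT a structure field; extra scored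
column «F3hs», N/A until typed, res-adj-1 to confirm/decline): Diff-stability of a bare family `tildeP : ℤ → AddSubgroup B` from
NEGATIVE source degrees under a HASSE–SCHMIDT divided-power system of `B` only, orders `1 ≤ |β|`: `D^{[β]}(tildeP i) ⊆ tildeP (i − |β|)`,
`i < 0`, parametric in the supplied HS system. The HS system is the tree's: a ring homomorphism `T : B → B⟦t_σ⟧` (Matsumura §27
higher derivation) with components `D^{[β]} := Resolution.hsComponent T β` (`TaylorOrderBound.lean`; Leibniz `hsComponent_mul`; each
`D^{[β]}` is a Grothendieck operator of order `≤ |β|`, `isDiffOpLE_hsComponentₗ`, so F3⁻ ⇒ F3hs: `F3hsAt_of_F3negAllAt`). Motivation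
(plan-1): the only Diff-stability a non-`O`-stable candidate (W1.3 R-flat tails, SWρ) can meet, since V3's field F3⁻ `diff_mem_neg`
quantifies over Grothendieck `IsDiffOpLE`, whose order-0 part contains every multiplication (E-H, res-D-pv-031 / plan-1 02:50:27Z (1)).

KERNEL (res-D-pv-031 §7, the «✓/✗» plan-1 asked for): **✗, and collapse-class.** (i) `F3hsAt.one_mem_of_pow_mem` — a negative piece
containing `y^{p^N}` with `D^{[e_j]} y = 1` forces `1 ∈ tildeP (i − p^N)` (Frobenius rule `hsComponent_smul_pow_expChar_pow`): the
W1.3 R-flat tails (`y(e)^{p^e} ∈ tilde(−1)`, `y(e)` a regular parameter) score F3hs ✗ given F7b-unit; (ii) `F3hsAt.not_mem_of_order` —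
at a LOCAL placement with a first-order adapted HS system (tree `HasseSchmidtLocalCriterion`: `hT0`, `hu : span u = 𝔪`, `hlin`),
F3hs ∧ F7b-unit exclude every element of finite `𝔪`-adic order from every negative piece; (iii) `tilde_neg_eq_bot_of_F3hs_of_negProper`
— with Krull (`IsNoetherianRing`) ALL NEGATIVE PIECES ARE `⊥`, using NO NormDemand, NO Frobenius, NO `O`-stability. §2 lifts (iii)
to the checklist: every inhabitant `I : PnegaInterfaceV3` satisfies F3hs at every guarded `P` for every `K`-trivial HS system
(`PnegaInterfaceV3.f3hsAt`, from the field `diff_mem_neg`), and F7b-unit is the field `neg_proper`; hence at a Noetherian LOCAL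
placement carrying an adapted HS system AND a guarded (37)-datum, EVERY inhabitant has all negative pieces `⊥`
(`PnegaInterfaceV3.tilde_neg_eq_bot_of_hsLocalDatum`) and therefore FAILS F7c `NonVanishing` (`not_nonVanishing_of_hsLocalDatum`) —
placement supplied as hypotheses (the regular stalks `O_{Z,ξ}` of a smooth `Z` with their Taylor HS system and `𝔪`-adic `℘` are
the intended instances; constructing one in the tree is res-type-087's `OriginLocalization` line, not done here). VERDICT-FREE
READING (res-D-pv-031, for the scorers): any blanket Diff-stability demand on negative SOURCES — Grothendieck (F3⁻, E-H) or
Hasse–Schmidt (F3hs) — is incompatible with F7b-unit ∧ F7c at the regular stalks of record; a discriminating Diff cell must restrict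
the SOURCE to named elements (F3.2 / F3.3 shapes), not the operator family. Suggested cell text (pv-031): «F3hs⁻: ✗-by-kernel for
every F7b∧F7c candidate; not discriminating». This file records, it does not rule; res-adj-1 / res-D-plan-1 word the cell.

HONEST FRAMING. Nothing here is a statement of H. Hironaka's manuscript *Resolution of singularities in positive characteristics*
(2017-03-23, [Hironaka2017], lit key `paper:url-3343fd9e678b`): `F3hs` is OURS (a rescue-instrument predicate named by res-D-plan-1),
asserted of no candidate for the manuscript's `℘nega`; the theorems are bookkeeping about typed statements. AI typing / AI kernel
work, weaker than expert review; nothing here is progress on resolution of singularities in positive characteristic; no claim beyond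
the kernel.
-/

noncomputable section

set_option linter.dupNamespace false -- mandated namespace of this single-conjunct summit

namespace Summit.ResolutionOfSingularities.ResolutionOfSingularities.Theorems.Campaign.PnegaObligation

open Literature.AlgebraicGeometry.Resolution
open IsLocalRing

universe u v w

/-! ## §1 F3hs — the HASSE–SCHMIDT restriction of F3⁻ (= §7 of res-D-pv-031's draft e9ca4e39239a5f55, verbatim) (res-D-plan-1 INTERFACE RULING E-G 02:50:27Z (3): «`F3hs` :=
Diff-stability of a bare tilde family under a Hasse–Schmidt divided-power system of `B`, orders `1 ≤ |α|`: `Δ_α(tilde i) ⊆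
tilde (i−|α|)`, `i < 0`, parametric in the supplied HS system») and the W1.3-tails kernel.

The HS system is the tree's: a ring homomorphism `T : B → B⟦t_σ⟧` (Matsumura §27 «higher derivation `E_t`») with components
`D^{[β]} := Resolution.hsComponent T β` (`TaylorOrderBound.lean`; Leibniz `hsComponent_mul`; `D^{[0]} = id` when
`constantCoeff ∘ T = id`; each `D^{[β]}` is a Grothendieck operator of order `≤ |β|`, `isDiffOpLE_hsComponentₗ`, so F3⁻ ⇒ F3hs).

KERNEL (the «✓/✗» asked for): **✗, and structurally so.** At a LOCAL placement whose HS system is first-order adapted to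
generators `u` of `𝔪` (the setting of the tree's `HasseSchmidtLocalCriterion.lean`: `hT0`, `hu`, `hlin` — every regular stalk
`O_{Z,ξ}` of the smooth `Z` carries one), F3hs⁻ together with F7b-unit («no unit in a negative piece») forces EVERY negative piece
to avoid every element of finite `𝔪`-adic order (`F3hsAt.not_mem_of_order`: the unit form of the local criterion,
`exists_hsComponent_isUnit_of_mem_of_not_mem`, extracts from `x ∈ 𝔪^s ∖ 𝔪^{s+1}` a UNIT `D^{[γ]} x`, `|γ| = s`, which F3hs
places in the negative piece of degree `i − s`); with Krull (`IsNoetherianRing`) that is every `x ≠ 0`, so ALL NEGATIVE PIECES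
ARE `⊥` (`tilde_neg_eq_bot_of_F3hs_of_negProper`) — no NormDemand, no Frobenius, no `O`-stability used. For the W1.3 R-flat
tails the witness is the one-liner `F3hsAt.one_mem_of_pow_mem` (Frobenius rule `hsComponent_smul_pow_expChar_pow`:
`D^{[p^N e_j]}(y^{p^N}) = (D^{[e_j]} y)^{p^N} = 1`). So the Hasse–Schmidt restriction does not rescue a blanket negative-source
Diff-stability field: «F3hs⁻ ∧ F7b-unit ⇒ ¬F7c» is a collapse-class cell like E-B / E-H; only SOURCE-restricted demands (F3.2 /
F3.3: named elements, not whole pieces) can discriminate. -/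

section HS

open Finsupp

variable {B : Type v} [CommRing B] {σ : Type w}

/-- **F3hs at one `P`** (data level, bare family; res-D-plan-1 ruling 02:50:27Z (3), text verbatim up to the carrier of the HS
system): for the Hasse–Schmidt homomorphism `T : B → B⟦t_σ⟧` with components `D^{[β]} = hsComponent T β`, every `β` with
`1 ≤ |β|`, every NEGATIVE degree `i` and every `f ∈ tildeP i`: `D^{[β]} f ∈ tildeP (i − |β|)`. OURS obligation shape, asserted of
no candidate. [folklore] -/
def F3hsAt (T : B →+* MvPowerSeries σ B) (tildeP : ℤ → AddSubgroup B) : Prop :=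
  ∀ β : σ →₀ ℕ, 0 < degree β → ∀ i : ℤ, i < 0 → ∀ f : B, f ∈ tildeP i → hsComponent T β f ∈ tildeP (i - degree β)

/-- **F3⁻ ⇒ F3hs**: the components of a Hasse–Schmidt homomorphism sending `K` to constants (and with `D^{[0]} = id`) are
`K`-linear differential operators of order `≤ |β|` (`isDiffOpLE_hsComponentₗ`), so V3's `diff_mem_neg` shape implies F3hs for
that system — F3hs is the WEAKER demand. [folklore] -/
theorem F3hsAt_of_F3negAllAt (K : Type u) [CommRing K] [Algebra K B] [DecidableEq σ] (T : B →+* MvPowerSeries σ B)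
    (hTK : ∀ r : K, T (algebraMap K B r) = MvPowerSeries.C (algebraMap K B r))
    (hT0 : ∀ b, MvPowerSeries.constantCoeff (T b) = b) (tildeP : ℤ → AddSubgroup B) (h : F3negAllAt K tildeP) :
    F3hsAt T tildeP := by
  intro β _hβ i hi f hf
  have hD := isDiffOpLE_hsComponentₗ T hTK hT0 (degree β) β le_rfl
  exact h (degree β) (hsComponentₗ T hTK β) hD i hi f hf

/-- **W1.3 witness (Frobenius rule).** If a negative piece `tildeP i` contains the `p^N`-th power of an element `y` with
`D^{[e_j]} y = 1` (a coordinate of the HS system — the R-flat tail generator `y(e)` is a regular parameter), then F3hs puts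
`1 = (D^{[e_j]} y)^{p^N} = D^{[p^N e_j]}(y^{p^N})` into `tildeP (i − p^N)`: a UNIT in a negative piece. So the W1.3 R-flat tails
(`y(e)^{p^e} ∈ tilde(−1)`, no units below `0`) score F3hs ✗. [folklore] -/
theorem F3hsAt.one_mem_of_pow_mem (T : B →+* MvPowerSeries σ B) (p : ℕ) [ExpChar B p] {tildeP : ℤ → AddSubgroup B}
    (h : F3hsAt T tildeP) {j : σ} {y : B} (hy : hsComponent T (single j 1) y = 1) (N : ℕ) (hN : 0 < p ^ N)
    {i : ℤ} (hi : i < 0) (hmem : y ^ p ^ N ∈ tildeP i) : (1 : B) ∈ tildeP (i - (p ^ N : ℕ)) := by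
  have hdeg : degree (p ^ N • single j 1 : σ →₀ ℕ) = p ^ N := by
    rw [map_nsmul, degree_single, smul_eq_mul, mul_one]
  have := h (p ^ N • single j 1) (by rw [hdeg]; exact hN) i hi _ hmem
  rwa [hsComponent_smul_pow_expChar_pow T p N (single j 1) y, hy, one_pow, hdeg] at this

variable {O : Type v} [CommRing O] [IsLocalRing O] {τ : Type w} [Fintype τ] [DecidableEq τ]

/-- **F3hs ∧ F7b-unit exclude every element of finite order from the negative pieces** (local placement with a first-order
adapted HS system — tree `HasseSchmidtLocalCriterion`: `hT0`, generators `u` of `𝔪`, `hlin`): for `x ∈ 𝔪^s ∖ 𝔪^{s+1}` the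
unit form of the local criterion gives `γ`, `|γ| = s`, with `D^{[γ]} x` a unit; if `x ∈ tildeP (−a)` then F3hs (for `s ≥ 1`) or
`x` itself (for `s = 0`) exhibits a unit in a negative piece. [folklore] -/
theorem F3hsAt.not_mem_of_order (T : O →+* MvPowerSeries τ O) (hT0 : ∀ b, MvPowerSeries.constantCoeff (T b) = b)
    {u : τ → O} (hu : Ideal.span (Set.range u) = IsLocalRing.maximalIdeal O)
    (hlin : ∀ i j, hsComponent T (single j 1) (u i) - (if i = j then 1 else 0) ∈ IsLocalRing.maximalIdeal O)
    {tildeP : ℤ → AddSubgroup O} (h : F3hsAt T tildeP)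
    (hunit : ∀ a : ℕ, 0 < a → ∀ v : O, IsUnit v → v ∉ tildeP (-(a : ℤ)))
    {x : O} {s : ℕ} (h1 : x ∈ IsLocalRing.maximalIdeal O ^ s) (h2 : x ∉ IsLocalRing.maximalIdeal O ^ (s + 1))
    (a : ℕ) (ha : 0 < a) : x ∉ tildeP (-(a : ℤ)) := by
  intro hx
  rcases Nat.eq_zero_or_pos s with rfl | hs
  · -- order 0: `x` is a unit
    have hxu : IsUnit x := by
      by_contra hnu
      exact h2 (by simpa using (IsLocalRing.mem_maximalIdeal x).2 hnu)
    exact hunit a ha x hxu hx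
  · obtain ⟨γ, hγ, hγu⟩ := exists_hsComponent_isUnit_of_mem_of_not_mem T hT0 hu hlin h1 h2
    have hmem := h γ (by rw [hγ]; exact hs) _ (by omega) x hx
    have hdeg : (-(a : ℤ) - (degree γ : ℕ)) = -((a + s : ℕ) : ℤ) := by rw [hγ]; push_cast; ring
    rw [hdeg] at hmem
    exact hunit (a + s) (by omega) _ hγu hmem

/-- **F3hs⁻ ∧ F7b-unit ⇒ ALL NEGATIVE PIECES VANISH** at a Noetherian local placement with a first-order adapted HS system
(every regular stalk `O_{Z,ξ}` of the smooth `Z`): by Krull every `x ≠ 0` has a finite order, and `F3hsAt.not_mem_of_order`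
excludes it. Hence F7c `NonVanishing` ✗ for every such candidate — with NO NormDemand, NO Frobenius and NO `O`-stability used:
the Hasse–Schmidt restriction of F3⁻ is still collapse-class. [folklore] -/
theorem tilde_neg_eq_bot_of_F3hs_of_negProper [IsNoetherianRing O] (T : O →+* MvPowerSeries τ O)
    (hT0 : ∀ b, MvPowerSeries.constantCoeff (T b) = b)
    {u : τ → O} (hu : Ideal.span (Set.range u) = IsLocalRing.maximalIdeal O)
    (hlin : ∀ i j, hsComponent T (single j 1) (u i) - (if i = j then 1 else 0) ∈ IsLocalRing.maximalIdeal O)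
    {tildeP : ℤ → AddSubgroup O} (h : F3hsAt T tildeP)
    (hunit : ∀ a : ℕ, 0 < a → ∀ v : O, IsUnit v → v ∉ tildeP (-(a : ℤ))) (a : ℕ) (ha : 0 < a) :
    tildeP (-(a : ℤ)) = ⊥ := by
  refine (AddSubgroup.eq_bot_iff_forall _).2 fun x hx => ?_
  by_contra hx0
  -- Krull: some power of `𝔪` misses `x`
  have hKrull : ∃ n : ℕ, x ∉ IsLocalRing.maximalIdeal O ^ n := by
    by_contra hall
    push Not at hall
    have : x ∈ ⨅ n : ℕ, IsLocalRing.maximalIdeal O ^ n := Ideal.mem_iInf.2 hall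
    rw [Ideal.iInf_pow_eq_bot_of_isLocalRing _ (IsLocalRing.maximalIdeal.isMaximal O).ne_top, Ideal.mem_bot] at this
    exact hx0 this
  classical
  let n := Nat.find hKrull
  have hn : x ∉ IsLocalRing.maximalIdeal O ^ n := Nat.find_spec hKrull
  have hn0 : n ≠ 0 := by
    intro h0
    apply hn
    rw [h0, pow_zero, Ideal.one_eq_top]
    trivial
  obtain ⟨s, hs⟩ : ∃ s, n = s + 1 := ⟨n - 1, by omega⟩
  have h1 : x ∈ IsLocalRing.maximalIdeal O ^ s := by
    by_contra hns
    have := Nat.find_min hKrull (show s < n by omega)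
    exact this hns
  exact F3hsAt.not_mem_of_order T hT0 hu hlin h hunit h1 (hs ▸ hn) a ha hx

end HS

end Summit.ResolutionOfSingularities.ResolutionOfSingularities.Theorems.Campaign.PnegaObligation

/-! ## §2 Over the checklist of record: every inhabitant of `PnegaInterfaceV3` meets F3hs, hence fails F7c at an adapted local
placement (typer res-L1-type-o2; composition of §1 (iii) with the structure fields `diff_mem_neg` and `neg_proper`) -/

namespace Summit.ResolutionOfSingularities.ResolutionOfSingularities.Theorems.Campaign.PnegaInterfaceV3

open Literature.AlgebraicGeometry.Resolution
open IsLocalRing Finsupp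

universe u v w

variable {K : Type u} [CommRing K] {p : ℕ} {prov : PnegaProvenance.{u, v} K}

/-- **F3⁻ (field) ⇒ F3hs for every inhabitant.** At a guarded `P`, an inhabitant's family `I.tilde P` satisfies
`PnegaObligation.F3hsAt T` for every Hasse–Schmidt homomorphism `T` of the placement that maps `K` to constants and has
`D^{[0]} = id` — because each component `D^{[β]}` is a `K`-differential operator of order `≤ |β|` and `diff_mem_neg` quantifies over
all of those (`PnegaObligation.F3hsAt_of_F3negAllAt`). So the column «F3hs» is FORCED ✓ on inhabitants of V3 as filed. [folklore] -/
theorem f3hsAt (I : PnegaInterfaceV3 K p prov) {B : Type v} [CommRing B] [Algebra K B] {σ : Type w} [DecidableEq σ]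
    (T : B →+* MvPowerSeries σ B) (hTK : ∀ r : K, T (algebraMap K B r) = MvPowerSeries.C (algebraMap K B r))
    (hT0 : ∀ b, MvPowerSeries.constantCoeff (T b) = b) (P : ℕ → Ideal B) (hP : IsCharFiltration K P) :
    PnegaObligation.F3hsAt T (I.tilde P) :=
  PnegaObligation.F3hsAt_of_F3negAllAt K T hTK hT0 (I.tilde P) fun μ D hD i hi f hf => I.diff_mem_neg P hP μ D hD i hi f hf

/-- **Every inhabitant has ALL NEGATIVE PIECES `⊥` at an adapted local placement with a datum.** Placement as hypotheses: `O` a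
Noetherian LOCAL `K`-algebra with a Hasse–Schmidt homomorphism `T` mapping `K` to constants, `D^{[0]} = id`, first-order adapted to
generators `u` of `𝔪` (`hu`, `hlin` — tree `HasseSchmidtLocalCriterion`); `P` a guarded filtration carrying a (37)-datum in the
checklist's sense (`0 < q`, `g ∈ P q`, unit clauses, `P q ≠ ⊤`). Then `I.tilde P (−a) = ⊥` for every `a > 0`: F3hs holds by `f3hsAt`,
F7b-unit by the field `neg_proper`, and `PnegaObligation.tilde_neg_eq_bot_of_F3hs_of_negProper` (Krull) concludes — NO NormDemand,
NO Frobenius, NO `O`-stability hypothesis. [folklore] -/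
theorem tilde_neg_eq_bot_of_hsLocalDatum (I : PnegaInterfaceV3 K p prov) {O : Type v} [CommRing O] [IsLocalRing O]
    [IsNoetherianRing O] [Algebra K O] {τ : Type w} [Fintype τ] [DecidableEq τ] (T : O →+* MvPowerSeries τ O)
    (hTK : ∀ r : K, T (algebraMap K O r) = MvPowerSeries.C (algebraMap K O r))
    (hT0 : ∀ b, MvPowerSeries.constantCoeff (T b) = b) {u : τ → O} (hu : Ideal.span (Set.range u) = maximalIdeal O)
    (hlin : ∀ i j, hsComponent T (single j 1) (u i) - (if i = j then 1 else 0) ∈ maximalIdeal O)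
    (P : ℕ → Ideal O) (hP : IsCharFiltration K P) (q : ℕ) (g : O) (hq : 0 < q) (hg : g ∈ P q)
    (h37 : ∀ k : ℕ, 0 < k → diffIdeal K (k * q) (Ideal.span {g ^ k}) = ⊤) (hPq : P q ≠ ⊤) (a : ℕ) (ha : 0 < a) :
    I.tilde P (-(a : ℤ)) = ⊥ :=
  PnegaObligation.tilde_neg_eq_bot_of_F3hs_of_negProper T hT0 hu hlin (I.f3hsAt T hTK hT0 P hP)
    (fun b hb v hv => I.neg_proper P hP q g hq hg h37 hPq b hb v hv) a ha

/-- **Kernel cell: F7c ✗ for every inhabitant admitting ONE adapted local placement with a datum.** Under the hypotheses of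
`tilde_neg_eq_bot_of_hsLocalDatum` (which the regular stalks `O_{Z,ξ}` of a smooth `Z`, `dim Z ≥ 1`, with their Taylor HS system
and the `𝔪`-adic `℘` are meant to meet — supplied here as hypotheses, not constructed), NO inhabitant of `PnegaInterfaceV3 K p prov`
is `NonVanishing`. Collapse-class, like E-B / E-H (res-D-pv-031's verdict-free reading: only SOURCE-restricted Diff demands — F3.2 /
F3.3 — can discriminate). Recorded for the scorers; not a ruling. [folklore] -/
theorem not_nonVanishing_of_hsLocalDatum (I : PnegaInterfaceV3 K p prov) {O : Type v} [CommRing O] [IsLocalRing O]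
    [IsNoetherianRing O] [Algebra K O] {τ : Type w} [Fintype τ] [DecidableEq τ] (T : O →+* MvPowerSeries τ O)
    (hTK : ∀ r : K, T (algebraMap K O r) = MvPowerSeries.C (algebraMap K O r))
    (hT0 : ∀ b, MvPowerSeries.constantCoeff (T b) = b) {u : τ → O} (hu : Ideal.span (Set.range u) = maximalIdeal O)
    (hlin : ∀ i j, hsComponent T (single j 1) (u i) - (if i = j then 1 else 0) ∈ maximalIdeal O)
    (P : ℕ → Ideal O) (hP : IsCharFiltration K P) (q : ℕ) (g : O) (hq : 0 < q) (hg : g ∈ P q)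
    (h37 : ∀ k : ℕ, 0 < k → diffIdeal K (k * q) (Ideal.span {g ^ k}) = ⊤) (hPq : P q ≠ ⊤) : ¬ I.NonVanishing := by
  intro hNV
  obtain ⟨a, ha, hne⟩ := hNV P hP q g hq hg h37 hPq
  exact hne (I.tilde_neg_eq_bot_of_hsLocalDatum T hTK hT0 hu hlin P hP q g hq hg h37 hPq a ha)

/-! ## §3 (v2, APPEND-ONLY) E-H over the TREE structure — res-D-pv-031's §6 (draft e9ca4e39239a5f55 / 74ccf2eee2d65902), carried on
res-D-plan-1's instruction 2026-08-27T03:07:07Z «o2: on res-D-pv-031's behalf — CARRY §6 + §7 … true over V3 as filed» (§7 = §1–§2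
above; §6 here — in this sibling because `…ObligationF31.lean` is at 371/400 lines). At V3.2 (rev 0.7, `diff_mem_neg` ↦ the scored
predicate `DiffStableNeg`) the same two statements hold under that predicate as hypothesis; res-D-plan-1 re-points then. -/

/-- **E-H on the tree structure** (res-D-pv-031): every inhabitant of `PnegaInterfaceV3` has `B`-STABLE negative pieces at every
guarded `P` (multiplication by `b` is `IsDiffOpLE K 0`, `Resolution.isDiffOpLE_mulLeft`; field `diff_mem_neg` at `μ = 0`). So F6c
`OStable` restricted to degrees `< 0` is a THEOREM of V3, not a scored cell; a `ρ^e(O)`-module-valued candidate (W1.3 / SWρ shape)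
inhabits V3 only if its negative pieces are in fact `O`-stable. Faithful to print (Def 5.1 p.25 L34 «O_Z-submodule»; res-D-plan-1
02:50:27Z (2)). [folklore] -/
theorem mul_mem_neg (I : PnegaInterfaceV3 K p prov) {B : Type v} [CommRing B] [Algebra K B]
    (P : ℕ → Ideal B) (hP : IsCharFiltration K P) (i : ℤ) (hi : i < 0) (b x : B) (hx : x ∈ I.tilde P i) :
    b * x ∈ I.tilde P i := by
  have := I.diff_mem_neg P hP 0 (LinearMap.mulLeft K b) (isDiffOpLE_mulLeft (R := K) b) i hi x hx
  simpa using this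

/-- **E-H consequence** (res-D-pv-031): an inhabitant of V3 satisfying F6d-elt `NormDemand e` with `p^e ≥ 2` has ALL negative
pieces `= ⊥` at every guarded `P` on every REGULAR LOCAL placement of positive dimension — by the tree squeeze
`Lib.PowIdeal.addSubgroup_eq_bot_of_mul_mem_of_subset_range_pow` fed with `mul_mem_neg`; NO `OStable` hypothesis (contrast
res-type-087's `tilde_neg_eq_bot_of_oStable_of_normDemand`, `MarkedTransferCampaignG1PnegaSqueezeV3.lean` p488544). Hence F6d-elt ✓ ⇒
F7c ✗ wherever the (37)-regime lives on such a placement: the decisive cell F6c × F6d × F7c cannot read (✗, ✓, ✓) for any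
inhabitant of V3 as filed. [folklore] -/
theorem tilde_neg_eq_bot_of_normDemand (I : PnegaInterfaceV3 K p prov) {e : ℕ} (hN : I.NormDemand e)
    (hq : 2 ≤ p ^ e) {O : Type v} [CommRing O] [Algebra K O] [IsRegularLocalRing O] (hm : maximalIdeal O ≠ ⊥)
    (P : ℕ → Ideal O) (hP : IsCharFiltration K P) (a : ℕ) (ha : 0 < a) : I.tilde P (-(a : ℤ)) = ⊥ :=
  Literature.AlgebraicGeometry.Hironaka2017.Lib.PowIdeal.addSubgroup_eq_bot_of_mul_mem_of_subset_range_pow hq hm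
    (fun r x hx => I.mul_mem_neg P hP _ (by omega) r x hx) (hN P a ha)

end Summit.ResolutionOfSingularities.ResolutionOfSingularities.Theorems.Campaign.PnegaInterfaceV3

end
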